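import Summits.QuantumFields.YangMills.Theorems.UnitScaleTiltProp7CovariantCurlOfGrad
import Summits.QuantumFields.YangMills.Theorems.UnitScaleTiltProp7CovHodgeSplit
import HarnessLib

/-!
# Route `UnitScaleTilt`, crux K1 «MinimiserStabilityRegPr» (stmt-QuantumFields-19200), line «route-R» (curved Hodge route) — THE CURRENT-PAIRING IDENTITY:
# the covariant codifferential of the curvature commutator `curl_{U}D_{U}φ = (R(U(∂p)) − 1)g` splits EXACTLY into a CURRENT term (transported difference of two
# plaquette variables acting on a transported value of `φ`) and a CURVATURE term (`R(U(∂p)) − 1` acting on a covariant DIFFERENCE of `φ`); paired with a Landau field `B`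
# this is `⟨curl_U B, curl_U D_Uφ⟩ = ⟨B, [J, φ̃]⟩ − ⟨B, F⌟D_Uφ⟩` — the cross term of `E(B + D_Uφ)` has NO `∇B` piece

Cell `ym3-torus`, D-0154 (3c) twin-width seat `ym-routeR-w1` (gen 0, session 2); `--supports stmt-QuantumFields-19200 --as helper`; THEOREMS ONLY (0 `def`, 0 `sorry`).
YM₃ on T³ is a ladder rung (R3), not the Clay problem; nothing here claims the stub, the crux, d = 4 or the mass gap.

WHY (numbers; memo `CURVED-N7-HODGE-LOCATE-routeRw1s2.md` v1.2 = 19200 evidence #58, §4′–§4″).  On the Hodge route the pinned representative's relative field is `Y = B + D_{U₀}φ`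
(✓p610574), and `E(Y) = E(B) + E(D_{U₀}φ) + 2Re⟨curl B, curl D_{U₀}φ⟩`.  Bounding the cross term by Cauchy–Schwarz is empty; bounding `curl D_{U₀}φ` crudely by `2a‖φ‖`
(✓p601297 `norm_curl_covD_le`) produces the value terms that the memo shows are NOT absorbable.  The identity of this file moves the derivative onto the BACKGROUND:
`D^*_ν((R(W) − 1)g) = (R(W̃) − R(W))ĝ + (R(W) − 1)(D^*_ν g)` with `W̃` the plaquette variable transported from `x − e_ν` and `ĝ` the transported value — the first summand
carries the lattice CURRENT `D^{1*}_{U₀}∂U₀` (the letter of (6)'s divergence clause `DivSmall`, `< ε₀L^{−3(K−n)}`; at an R2-critical background the multiplier field `Q^*Λ`),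
the second a covariant difference of `φ` times `O(a)`.  So the cross term = current pairing − an `O(a)·M` term, and stub P's residue on this route is the current pairing
alone (memo (JC)∕(JC′)).  This file is the exact algebra every branch that keeps the pinned representative consumes; it asserts no estimate.

WHAT IS PROVED (sorry-free, no definition; `B9Eq39Adjoint` letters `R`, `covD`, `covDstar`, `curl`, `divP`, `plaqU`; abstract sites `S`, shifts `T : ι → Equiv.Perm S`,
background `U : ι → S → 𝔸ˣ`).
* §1 (any ring) ★ `covDstar_conj_sub` — LEIBNIZ for the codifferential of `y ↦ R(W(y))g(y) − g(y)`:
  `D^*_ν[(R(W) − 1)g](x) = (R(V⁻¹W(x−e_ν)V) − R(W(x)))ĝ + (R(W(x)) − 1)(D^*_νg)(x)`, `V = U_ν(x−e_ν)`, `ĝ = R(V⁻¹)g(x−e_ν)`;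
  ★ `divP_curl_covD_eq` — with commuting shifts, `(D^*(curl_U D_Uφ))_μ(x) = Σ_ν [current term + curvature term]` componentwise, EXACT (✓p601297 `curl_covD_eq_conj_plaqU` + `divP_curl`).
* §2 (`M_N(ℂ)`, unitary background on the torus `torusT`) ★★ `sum_re_trace_curl_mul_curl_covD` — the Hilbert–Schmidt pairing
  `Σ_{p} Re tr((curl_U B)(p)ᴴ·(curl_U D_Uφ)(p)) = Σ_x Σ_μ Re tr(B_μ(x)ᴴ·(D^*(curl_U D_Uφ))_μ(x))` (✓`B9Eq39Adjoint.sum_curl_mul`, `conjTranspose_curl`), and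
  ★★★ `sum_re_trace_curl_mul_curl_covD_eq_current_add_curv` — the same with §1 substituted: CURRENT PAIRING + CURVATURE PAIRING, exact.
* §3 ★ `hs_energy_split` — `Σ_p|curl(B + D_Uφ)|²_HS = Σ_p|curl B|²_HS + Σ_p|curl D_Uφ|²_HS + 2·Σ_p Re tr((curl B)ᴴ curl D_Uφ)` (HS binomial, any background).

HONEST SCOPE.  Exact lattice algebra at a unitary background ([folklore] in [Balaban1985BackgroundPropagators] (3.3)–(3.9) letters); no bound on the current pairing is claimed —
that bound IS the located residue (JC′) of stub P on the Hodge route.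

References: T. Bałaban, CMP 99 (1985) 389–434 [Balaban1985BackgroundPropagators] ((3.3)–(3.4) pp.390–391, (3.8)–(3.9) p.392); CMP 99 (1985) 75–102 [Balaban1985RegularSpaces]
((1.2) p.76, (1.9) p.77: the covariant divergence of `∂U`); CMP 102 (1985) 277–309 [Balaban1985Variational] ((2) p.278, Prop. 7 p.299).
-/

set_option autoImplicit false

noncomputable section

open scoped BigOperators Matrix.Norms.L2Operator Matrix

namespace Summit.QuantumFields.YangMills.Theorems.Prop7CovCurrentPairing

open Literature.MathematicalPhysics.QuantumFieldTheory.Balaban1983to89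
open B9Eq39Adjoint (R R_def R_add R_sub R_inv_R R_R_inv covD covDstar curl divB divP plaqU divP_curl sum_curl_mul curl_swap curl_self)
open Summit.QuantumFields.YangMills.Theorems.Prop7CovariantCurlOfGrad (curl_covD_eq_conj_plaqU)

/-! ## §1 Leibniz for the codifferential of a conjugation defect; the codifferential of the curvature commutator -/

section RingLevel

variable {𝔸 : Type*} [Ring 𝔸] {S : Type*} {ι : Type*} (T : ι → Equiv.Perm S) (U : ι → S → 𝔸ˣ)

/-- ★ **LEIBNIZ FOR `D^*_ν` OF A CONJUGATION DEFECT**: for a unit-valued site field `W` and a site field `g`,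
`D^*_ν[(R(W) − 1)g](x) = (R(V⁻¹·W(x−e_ν)·V) − R(W(x)))ĝ + (R(W(x)) − 1)(D^*_ν g)(x)` with `V = U_ν(x−e_ν)`, `ĝ = R(V⁻¹)g(x−e_ν)` — the transported DIFFERENCE of the two
unit values acts on a transported VALUE of `g`, the unit defect at `x` acts on the covariant DIFFERENCE of `g`. [folklore] [cite: Balaban1985BackgroundPropagators, (3.8) p.392] -/
theorem covDstar_conj_sub (W : S → 𝔸ˣ) (g : S → 𝔸) (ν : ι) (x : S) :
    covDstar T U ν (fun y => R (W y) (g y) - g y) x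
      = (R ((U ν ((T ν).symm x))⁻¹ * W ((T ν).symm x) * U ν ((T ν).symm x)) (R (U ν ((T ν).symm x))⁻¹ (g ((T ν).symm x)))
          - R (W x) (R (U ν ((T ν).symm x))⁻¹ (g ((T ν).symm x))))
        + (R (W x) (covDstar T U ν g x) - covDstar T U ν g x) := by
  simp only [covDstar, R_sub, B9Eq39Adjoint.R_mul, R_R_inv]
  abel

/-- ★ **THE CODIFFERENTIAL OF THE CURVATURE COMMUTATOR, EXACT** (commuting shifts): with `W_ν(y) := U(∂p_{νμ}(y))` (`plaqU`), `g_ν(y) := R(U_{y,μ}U_{y+e_μ,ν})φ(y+e_μ+e_ν)`,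
`V_ν := U_ν(x−e_ν)`, `ĝ_ν := R(V_ν⁻¹)g_ν(x−e_ν)`:
`(D^*(curl_U D_Uφ))_μ(x) = Σ_ν [ (R(V_ν⁻¹W_ν(x−e_ν)V_ν) − R(W_ν(x)))ĝ_ν + (R(W_ν(x)) − 1)(D^*_ν g_ν)(x) ]` — CURRENT term + CURVATURE term.
[cite: Balaban1985BackgroundPropagators, (3.4) p.391, (3.9) p.392; Balaban1985RegularSpaces, (1.2) p.76] -/
theorem divP_curl_covD_eq (hT : ∀ (μ ν : ι) (x : S), T μ (T ν x) = T ν (T μ x)) [Fintype ι] [LinearOrder ι]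
    (φ : S → 𝔸) (μ : ι) (x : S) :
    divP T U (curl T U (fun κ => covD T U κ φ)) μ x
      = ∑ ν, ((R ((U ν ((T ν).symm x))⁻¹ * plaqU T U ν μ ((T ν).symm x) * U ν ((T ν).symm x))
                  (R (U ν ((T ν).symm x))⁻¹ (R (U μ ((T ν).symm x) * U ν (T μ ((T ν).symm x))) (φ (T ν (T μ ((T ν).symm x))))))
              - R (plaqU T U ν μ x)
                  (R (U ν ((T ν).symm x))⁻¹ (R (U μ ((T ν).symm x) * U ν (T μ ((T ν).symm x))) (φ (T ν (T μ ((T ν).symm x)))))))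
            + (R (plaqU T U ν μ x) (covDstar T U ν (fun y => R (U μ y * U ν (T μ y)) (φ (T ν (T μ y)))) x)
                - covDstar T U ν (fun y => R (U μ y * U ν (T μ y)) (φ (T ν (T μ y)))) x)) := by
  rw [divP_curl]
  refine Finset.sum_congr rfl fun ν _ => ?_
  have hcurl : curl T U (fun κ => covD T U κ φ) ν μ
      = fun y => R (plaqU T U ν μ y) (R (U μ y * U ν (T μ y)) (φ (T ν (T μ y)))) - R (U μ y * U ν (T μ y)) (φ (T ν (T μ y))) := by
    funext y
    exact curl_covD_eq_conj_plaqU T U φ ν μ y (hT μ ν y)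
  rw [hcurl]
  exact covDstar_conj_sub T U (fun y => plaqU T U ν μ y) (fun y => R (U μ y * U ν (T μ y)) (φ (T ν (T μ y)))) ν x

end RingLevel

/-! ## §2 The Hilbert–Schmidt pairing on the torus at a unitary background: `⟨curl_U B, curl_U D_Uφ⟩` = current pairing + curvature pairing -/

section Torus

open B9TorusCalculus (torusT torusT_apply torusT_symm_apply torusT_comm)
open Summit.QuantumFields.YangMills.Theorems.Prop7CovariantCoercivity (conjTranspose_curl re_trace_mul_comm abs_re_trace_curv_le inv_mem_unitary)
open Summit.QuantumFields.YangMills.Theorems.Prop7CovHodgeSplit (sum_normSq_add_eq)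

variable {P : Params} {i : ℕ} {N : ℕ} (U : Fin P.d → Site P i → (Matrix (Fin N) (Fin N) ℂ)ˣ)

/-- the curl is additive in the bond field. [folklore] -/
theorem curl_add (A A' : Fin P.d → Site P i → Matrix (Fin N) (Fin N) ℂ) (μ ν : Fin P.d) (x : Site P i) :
    curl (torusT P i) U (fun κ z => A κ z + A' κ z) μ ν x = curl (torusT P i) U A μ ν x + curl (torusT P i) U A' μ ν x := by
  simp only [curl, covD, R_add]
  abel

/-- ★★ **THE CROSS TERM IS A PAIRING OF `B` WITH THE CODIFFERENTIAL OF THE CURVATURE COMMUTATOR** (unitary background, (3.9) adjointness for the real trace pairing):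
`Σ_x Σ_{μ<ν} Re tr((curl_U B)_{μν}(x)ᴴ·(curl_U D_Uφ)_{μν}(x)) = Σ_x Σ_μ Re tr(B_μ(x)ᴴ·(D^*(curl_U D_Uφ))_μ(x))`. [cite: Balaban1985BackgroundPropagators, (3.9) p.392] -/
theorem sum_re_trace_curl_mul_curl_covD (hU : ∀ (ν : Fin P.d) (x : Site P i), (U ν x : Matrix (Fin N) (Fin N) ℂ) ∈ unitary (Matrix (Fin N) (Fin N) ℂ))
    (B : Fin P.d → Site P i → Matrix (Fin N) (Fin N) ℂ) (φ : Site P i → Matrix (Fin N) (Fin N) ℂ) :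
    ∑ x : Site P i, ∑ μ : Fin P.d, ∑ ν : Fin P.d,
        (if μ < ν then (((curl (torusT P i) U B μ ν x)ᴴ * curl (torusT P i) U (fun κ => covD (torusT P i) U κ φ) μ ν x).trace).re else 0)
      = ∑ x : Site P i, ∑ μ : Fin P.d,
          (((B μ x)ᴴ * divP (torusT P i) U (curl (torusT P i) U (fun κ => covD (torusT P i) U κ φ)) μ x).trace).re := by
  set τ := Complex.reAddGroupHom.comp (Matrix.traceAddMonoidHom (Fin N) ℂ) with hτ
  have hτa : ∀ a : Matrix (Fin N) (Fin N) ℂ, τ a = (a.trace).re := fun a => by simp [hτ]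
  have h := sum_curl_mul (torusT P i) U τ re_trace_mul_comm (fun κ z => (B κ z)ᴴ) (curl (torusT P i) U (fun κ => covD (torusT P i) U κ φ))
  have hl : ∀ (x : Site P i) (μ ν : Fin P.d),
      τ (curl (torusT P i) U (fun κ z => (B κ z)ᴴ) μ ν x * curl (torusT P i) U (fun κ => covD (torusT P i) U κ φ) μ ν x)
        = (((curl (torusT P i) U B μ ν x)ᴴ * curl (torusT P i) U (fun κ => covD (torusT P i) U κ φ) μ ν x).trace).re := by
    intro x μ ν
    rw [← conjTranspose_curl hU, hτa]
  have hr : ∀ (x : Site P i) (μ : Fin P.d),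
      τ ((B μ x)ᴴ * divP (torusT P i) U (curl (torusT P i) U (fun κ => covD (torusT P i) U κ φ)) μ x)
        = (((B μ x)ᴴ * divP (torusT P i) U (curl (torusT P i) U (fun κ => covD (torusT P i) U κ φ)) μ x).trace).re := fun x μ => hτa _
  simp only [hl, hr] at h
  exact h

/-- ★★★ **THE CURRENT-PAIRING IDENTITY** (unitary background, `M_N(ℂ)`): the Hilbert–Schmidt cross term of `curl_U B` and `curl_U D_Uφ` is the pairing of `B` with the sum over `ν` of a
CURRENT term (transported difference of the plaquette variables `U(∂p_{νμ}(x−e_ν))`, `U(∂p_{νμ}(x))` acting on a transported value of `φ`) and a CURVATURE term (`R(U(∂p)) − 1` acting on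
a transported covariant difference `D^*_ν g_ν` of `φ`) — §1's `divP_curl_covD_eq` inside §2's adjointness; EXACT, no estimate.
[cite: Balaban1985BackgroundPropagators, (3.4) p.391, (3.9) p.392; Balaban1985RegularSpaces, (1.2) p.76] -/
theorem sum_re_trace_curl_mul_curl_covD_eq_current_add_curv
    (hU : ∀ (ν : Fin P.d) (x : Site P i), (U ν x : Matrix (Fin N) (Fin N) ℂ) ∈ unitary (Matrix (Fin N) (Fin N) ℂ))
    (B : Fin P.d → Site P i → Matrix (Fin N) (Fin N) ℂ) (φ : Site P i → Matrix (Fin N) (Fin N) ℂ) :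
    ∑ x : Site P i, ∑ μ : Fin P.d, ∑ ν : Fin P.d,
        (if μ < ν then (((curl (torusT P i) U B μ ν x)ᴴ * curl (torusT P i) U (fun κ => covD (torusT P i) U κ φ) μ ν x).trace).re else 0)
      = ∑ x : Site P i, ∑ μ : Fin P.d, (((B μ x)ᴴ *
          ∑ ν : Fin P.d,
            ((R ((U ν (x.unshift ν))⁻¹ * plaqU (torusT P i) U ν μ (x.unshift ν) * U ν (x.unshift ν))
                  (R (U ν (x.unshift ν))⁻¹ (R (U μ (x.unshift ν) * U ν ((x.unshift ν).shift μ)) (φ (((x.unshift ν).shift μ).shift ν))))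
              - R (plaqU (torusT P i) U ν μ x)
                  (R (U ν (x.unshift ν))⁻¹ (R (U μ (x.unshift ν) * U ν ((x.unshift ν).shift μ)) (φ (((x.unshift ν).shift μ).shift ν)))))
            + (R (plaqU (torusT P i) U ν μ x) (covDstar (torusT P i) U ν (fun y => R (U μ y * U ν (y.shift μ)) (φ ((y.shift μ).shift ν))) x)
                - covDstar (torusT P i) U ν (fun y => R (U μ y * U ν (y.shift μ)) (φ ((y.shift μ).shift ν))) x))).trace).re := by
  rw [sum_re_trace_curl_mul_curl_covD U hU B φ]
  refine Finset.sum_congr rfl fun x _ => Finset.sum_congr rfl fun μ _ => ?_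
  rw [divP_curl_covD_eq (torusT P i) U (fun μ' ν' y => torusT_comm μ' ν' y) φ μ x]
  simp only [torusT_apply, torusT_symm_apply]

/-- ★ **THE HILBERT–SCHMIDT ENERGY SPLIT** of `curl_U(B + D_Uφ)` over the positively oriented plaquettes: `Σ|curl(B + D_Uφ)|²_HS = Σ|curl B|²_HS + Σ|curl D_Uφ|²_HS + 2·Σ Re tr((curl D_Uφ)ᴴ·curl B)`
— together with `sum_re_trace_curl_mul_curl_covD_eq_current_add_curv` (and `Re tr(QᴴP) = Re tr(PᴴQ)`) this is `E(Y) = E(B) + E(D_Uφ) + 2·(current pairing + curvature pairing)`. [folklore] -/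
theorem hs_energy_split (B : Fin P.d → Site P i → Matrix (Fin N) (Fin N) ℂ) (φ : Site P i → Matrix (Fin N) (Fin N) ℂ) :
    ∑ x : Site P i, ∑ μ : Fin P.d, ∑ ν : Fin P.d, (if μ < ν then
        ∑ a : Fin N, ∑ b : Fin N, Complex.normSq ((curl (torusT P i) U (fun κ z => B κ z + covD (torusT P i) U κ φ z) μ ν x) a b) else 0)
      = ∑ x : Site P i, ∑ μ : Fin P.d, ∑ ν : Fin P.d, (if μ < ν then
            ∑ a : Fin N, ∑ b : Fin N, Complex.normSq ((curl (torusT P i) U B μ ν x) a b) else 0)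
        + ∑ x : Site P i, ∑ μ : Fin P.d, ∑ ν : Fin P.d, (if μ < ν then
            ∑ a : Fin N, ∑ b : Fin N, Complex.normSq ((curl (torusT P i) U (fun κ => covD (torusT P i) U κ φ) μ ν x) a b) else 0)
        + 2 * ∑ x : Site P i, ∑ μ : Fin P.d, ∑ ν : Fin P.d, (if μ < ν then
            (((curl (torusT P i) U (fun κ => covD (torusT P i) U κ φ) μ ν x)ᴴ * curl (torusT P i) U B μ ν x).trace).re else 0) := by
  rw [Finset.mul_sum, ← Finset.sum_add_distrib, ← Finset.sum_add_distrib]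
  refine Finset.sum_congr rfl fun x _ => ?_
  rw [Finset.mul_sum, ← Finset.sum_add_distrib, ← Finset.sum_add_distrib]
  refine Finset.sum_congr rfl fun μ _ => ?_
  rw [Finset.mul_sum, ← Finset.sum_add_distrib, ← Finset.sum_add_distrib]
  refine Finset.sum_congr rfl fun ν _ => ?_
  split_ifs with h
  · rw [curl_add, sum_normSq_add_eq]
  · simp

/-- ★ **THE CURVATURE PAIRING IS `O(a)` AND VALUE-FREE**: if `‖U(∂p_{νμ}(x)) − 1‖ ≤ a`, then for all `X`, `Z`,
`|Re tr(Xᴴ·(R(U(∂p))Z − Z))| ≤ a·(|X|²_HS + |Z|²_HS)` (✓`Prop7TracePairing.abs_re_trace_curv_le` at `t = 1`) — read at `X = B_μ(x)`, `Z = (D^*_ν g_ν)(x)`, this bounds every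
curvature term of the identity; the CURRENT terms are left displayed (they are stub P's located residue on this route). [cite: Balaban1985Variational, (135) p.298] -/
theorem abs_re_trace_conjTranspose_mul_conj_sub_le [NeZero N]
    (hU : ∀ (ν : Fin P.d) (x : Site P i), (U ν x : Matrix (Fin N) (Fin N) ℂ) ∈ unitary (Matrix (Fin N) (Fin N) ℂ))
    {a : ℝ} (ν μ : Fin P.d) (x : Site P i) (ha : ‖(plaqU (torusT P i) U ν μ x : Matrix (Fin N) (Fin N) ℂ) - 1‖ ≤ a) (X Z : Matrix (Fin N) (Fin N) ℂ) :
    |((Xᴴ * (R (plaqU (torusT P i) U ν μ x) Z - Z)).trace).re|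
      ≤ a * (∑ j : Fin N, ∑ k : Fin N, ‖X j k‖ ^ 2 + ∑ j : Fin N, ∑ k : Fin N, ‖Z j k‖ ^ 2) := by
  have hW : (plaqU (torusT P i) U ν μ x : Matrix (Fin N) (Fin N) ℂ) ∈ unitary (Matrix (Fin N) (Fin N) ℂ) := by
    simp only [plaqU, Units.val_mul]
    exact mul_mem (mul_mem (mul_mem (hU _ _) (hU _ _)) (inv_mem_unitary (hU _ _))) (inv_mem_unitary (hU _ _))
  have h1 : ((1 : (Matrix (Fin N) (Fin N) ℂ)ˣ) : Matrix (Fin N) (Fin N) ℂ) ∈ unitary (Matrix (Fin N) (Fin N) ℂ) := by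
    rw [Units.val_one]; exact Submonoid.one_mem _
  have h := abs_re_trace_curv_le h1 hW ha X Z
  simpa only [B9Eq39Adjoint.R_one] using h

end Torus

end Summit.QuantumFields.YangMills.Theorems.Prop7CovCurrentPairing

end
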